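import Mathlib
import HarnessLib
import Summits.Ventures.LatticeQCDFlow.Exactness.IMHAnyStartReplicas
import Summits.Ventures.LatticeQCDFlow.Scaling.AutoregressiveGaugeHeatBathColdExact

/-!
# LatticeQCDFlow / Scaling — many short runs of the exact one-plaquette heat-bath sampler (`A = Z/(c^{#B} M^k)`) from ARBITRARY starts: the grand mean of `R` independent runs, `b` configurations discarded and `N` kept each, has `E(Ȳ − π f)² ≤ [(2/A − 1)·Var_π f/N + (1 − A)^b·D²]/R + (1 − 1/R)·(D·(1 − A)^b·min(1, (1/A)/N))²`

HONEST FRAMING: exact (Metropolis-corrected) sampling algorithms for lattice gauge theory;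
figures of merit are autocorrelation/cost numbers at stated couplings and volumes; no
continuum-physics claim.

Venture `LatticeQCDFlow` (cell pub-lqcd), topic `Scaling`, FANOUT row 30 (lean-1, GEN-35) — OUR WORK, the gauge instance of this
generation's abstract `Exactness/IMHAnyStartReplicas`.  Setting as in GEN-28's `heatBath_cold_acceptMass_eq`: exact sampler `K = indepMH q w`, cold
configuration `U ≡ 1` = the mode of the importance weight, `A = Z/(c^{#B} M^k)`; `R` runs `X_0, …, X_{R−1}` on one probability space, `X_j` distributed as
the sampler's run from an ARBITRARY initial configuration law `μ_j`; `Y_j = (1/N)Σ_{i<N} f(X_j(b+i))` the window averages after `b` discarded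
configurations, `Ȳ` their grand mean (`Scoring.replicaMean`), `D = max(π f − a, c − π f)`.  GEN-32 priced COLD-started replicas exactly
(`…ColdStartReplicas`: the floor `(δ·S_N/N)²`); from arbitrary starts:

* **`heatBath_replicas_anyStart_mse_le`** — pairwise independent runs: `E(Ȳ − π f)² ≤ [(2/A − 1)·Var_π f/N + (1 − A)^b·D²]/R +
  (1 − 1/R)·(D·(1 − A)^b·min(1, (1/A)/N))²` — REPLICATION DIVIDES THE FLUCTUATION AND THE START'S SECOND-ORDER TERM; ONLY THE SQUARED
  START-UP BIAS SURVIVES;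
* **`heatBath_replicas_anyStart_mse_le_of_log_le`** — `log(1/ε) ≤ b·A` ⇒ `≤ [(2/A − 1)·Var_π f/N + ε·D²]/R + (1 − 1/R)·(ε·D·min(1, (1/A)/N))²`;
* **`heatBath_replicas_anyStart_median`** — mutually independent runs, `4·[(2/A − 1)·Var_π f/N + (1 − A)^b·D²] ≤ s²` ⇒
  `P(#{j < R : |Y_j − π f| ≥ s} ≥ R/2) ≤ exp(−R/8)`: the median of the runs is within `s` of `π f` with probability `≥ 1 − e^{−R/8}`, whatever the starts.

NOT CLAIMED: a lower bound for arbitrary starts (GEN-32's floor is the cold start's); runs sharing proposals or random numbers (pairwise ∕ mutual independence is assumed); the between-run error estimator; any value of `A`.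

The `Fact` instance is the measurability of the kernel weight (discharged by the measurability clause of GEN-28's
acceptance-mass theorem).  No `def`, no `sorry`, nothing cited as a fact beyond the tree.
-/

noncomputable section

namespace Summit.Ventures.LatticeQCDFlow.Theory2.Autoregressive

open MeasureTheory ProbabilityTheory Function Finset
open scoped ENNReal
open Literature.MathematicalPhysics.QuantumFieldTheory Literature.MathematicalPhysics.QuantumLattice
open Summit.Ventures.LatticeQCDFlow.Exactness Summit.Ventures.LatticeQCDFlow.Scoring

variable {d L : ℕ} [NeZero L] {G : Type*} [Group G] [TopologicalSpace G] [IsTopologicalGroup G]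
  [CompactSpace G] [SecondCountableTopology G] [MeasurableSpace G] [BorelSpace G]

/-- **MANY SHORT RUNS FROM ARBITRARY STARTS**: on a probability space carrying `R ≥ 1` pairwise independent runs `X_0, …, X_{R−1}` of the sampler, `X_j` started from an ARBITRARY configuration law `μ_j` (e.g. each from a draw of its own autoregressive proposal), `b` configurations discarded and `N ≥ 1` kept: the grand mean `Ȳ` of the window averages has `E(Ȳ − π f)² ≤ [(2/A − 1)·Var_π f/N + (1 − A)^b·D²]/R + (1 − 1/R)·(D·(1 − A)^b·min(1, (1/A)/N))²`, `D = max(π f − a, c − π f)` — replication divides the fluctuation and the start's second-order term; only the squared start-up bias survives (exact one-plaquette heat-bath sampler, `A = Z/(c^{#B} M^k)`). [ours] -/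
theorem heatBath_replicas_anyStart_mse_le [MeasurableSingletonClass G] (hL : 2 ≤ L) {w : G → ℝ} (hw : Continuous w) {m M : ℝ} (hm0 : 0 < m)
    (hm : ∀ g, m ≤ w g) (hM : ∀ g, w g ≤ M) (hw1 : w 1 = M)
    (B : Finset (Plaquette d L)) (t : Plaquette d L → Edge d L)
    (ht : ∀ p ∈ B, t p ∈ ({(p.1, p.2.1.1), (p.1.shift p.2.1.1, p.2.1.2),
        (p.1.shift p.2.1.2, p.2.1.1), (p.1, p.2.1.2)} : Finset (Edge d L)))
    (rank : Plaquette d L → ℕ)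
    (hrank : ∀ p ∈ B, ∀ p' ∈ B, p ≠ p' → t p ∈ ({(p'.1, p'.2.1.1), (p'.1.shift p'.2.1.1, p'.2.1.2),
        (p'.1.shift p'.2.1.2, p'.2.1.1), (p'.1, p'.2.1.2)} : Finset (Edge d L)) → rank p < rank p')
    (π q : Measure (GaugeConfig d L G)) [IsProbabilityMeasure π] [IsProbabilityMeasure q]
    (hπ : π = (Measure.pi fun _ : Edge d L => haarProbability G).withDensity fun U =>
      ENNReal.ofReal ((∏ p : Plaquette d L, w (plaquetteHolonomy U p.1 p.2.1.1 p.2.1.2)) /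
        ∫ V, ∏ p : Plaquette d L, w (plaquetteHolonomy V p.1 p.2.1.1 p.2.1.2)
          ∂(Measure.pi fun _ : Edge d L => haarProbability G)))
    (hq : q = (Measure.pi fun _ : Edge d L => haarProbability G).withDensity fun U =>
      ENNReal.ofReal ((∏ p ∈ B, w (plaquetteHolonomy U p.1 p.2.1.1 p.2.1.2)) /
        ∫ V, ∏ p ∈ B, w (plaquetteHolonomy V p.1 p.2.1.1 p.2.1.2)
          ∂(Measure.pi fun _ : Edge d L => haarProbability G)))
    [Fact (Measurable (fun U =>
        ((∫ V, ∏ p : Plaquette d L, w (plaquetteHolonomy V p.1 p.2.1.1 p.2.1.2) ∂(Measure.pi fun _ : Edge d L => haarProbability G)) /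
          ((∫ V, ∏ p ∈ B, w (plaquetteHolonomy V p.1 p.2.1.1 p.2.1.2)
            ∂(Measure.pi fun _ : Edge d L => haarProbability G)) *
            ∏ p ∈ Finset.univ \ B, w (plaquetteHolonomy U p.1 p.2.1.1 p.2.1.2)))⁻¹))]
    {Ω' : Type*} {mΩ' : MeasurableSpace Ω'} {μ : Measure Ω'} [IsProbabilityMeasure μ]
    {X : ℕ → Ω' → (ℕ → GaugeConfig d L G)} {μ₀ : ℕ → Measure (GaugeConfig d L G)} [∀ j, IsProbabilityMeasure (μ₀ j)] {R : ℕ}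
    {f : GaugeConfig d L G → ℝ} (hf : Measurable f) {a c : ℝ} (ha : ∀ U, a ≤ f U) (hc : ∀ U, f U ≤ c) (b : ℕ) {N : ℕ}
    (hN : N ≠ 0) (hXm : ∀ j, Measurable (X j))
    (hlaw : ∀ j < R, μ.map (X j) = (Kernel.trajMeasure (X := fun _ : ℕ => GaugeConfig d L G) (μ₀ j)
        (fun n : ℕ => (indepMH q (fun U =>
        ((∫ V, ∏ p : Plaquette d L, w (plaquetteHolonomy V p.1 p.2.1.1 p.2.1.2) ∂(Measure.pi fun _ : Edge d L => haarProbability G)) /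
          ((∫ V, ∏ p ∈ B, w (plaquetteHolonomy V p.1 p.2.1.1 p.2.1.2)
            ∂(Measure.pi fun _ : Edge d L => haarProbability G)) *
            ∏ p ∈ Finset.univ \ B, w (plaquetteHolonomy U p.1 p.2.1.1 p.2.1.2)))⁻¹)).comap
          (fun h : (i : ↥(Finset.Iic n)) → GaugeConfig d L G => h ⟨n, Finset.mem_Iic.2 le_rfl⟩)
          (measurable_pi_apply _)))) (hR : R ≠ 0)
    (hind : ∀ i < R, ∀ j < R, i ≠ j → IndepFun (X i) (X j) μ) :
    ∫ ω, (replicaMean (fun j ω => (∑ i ∈ range N, f (X j ω (b + i))) / N) R ω - ∫ U, f U ∂π) ^ 2 ∂μ ≤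
      ((2 * ((∫ V, ∏ p : Plaquette d L, w (plaquetteHolonomy V p.1 p.2.1.1 p.2.1.2) ∂(Measure.pi fun _ : Edge d L => haarProbability G)) /
        ((∫ g, w g ∂(haarProbability G)) ^ B.card * M ^ (Finset.univ \ B).card))⁻¹ - 1) *
            (∫ U, (f U - ∫ V, f V ∂π) ^ 2 ∂π) / N +
          (1 - ((∫ V, ∏ p : Plaquette d L, w (plaquetteHolonomy V p.1 p.2.1.1 p.2.1.2) ∂(Measure.pi fun _ : Edge d L => haarProbability G)) /
        ((∫ g, w g ∂(haarProbability G)) ^ B.card * M ^ (Finset.univ \ B).card))) ^ b * (max (∫ U, f U ∂π - a) (c - ∫ U, f U ∂π)) ^ 2) / R +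
        (1 - 1 / R) * (max (∫ U, f U ∂π - a) (c - ∫ U, f U ∂π) *
          ((1 - ((∫ V, ∏ p : Plaquette d L, w (plaquetteHolonomy V p.1 p.2.1.1 p.2.1.2) ∂(Measure.pi fun _ : Edge d L => haarProbability G)) /
        ((∫ g, w g ∂(haarProbability G)) ^ B.card * M ^ (Finset.univ \ B).card))) ^ b * min 1 (((∫ V, ∏ p : Plaquette d L, w (plaquetteHolonomy V p.1 p.2.1.1 p.2.1.2) ∂(Measure.pi fun _ : Edge d L => haarProbability G)) /
        ((∫ g, w g ∂(haarProbability G)) ^ B.card * M ^ (Finset.univ \ B).card))⁻¹ / N))) ^ 2 := by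
  obtain ⟨hA, hρq, hmax, hρm, hρpos⟩ := heatBath_cold_acceptMass_eq hL hw hm0 hm hM hw1 B t ht rank hrank π q hπ hq
  set cold : GaugeConfig d L G := fun _ => (1 : G) with hcold
  set ρ : GaugeConfig d L G → ℝ := fun U => ((∫ V, ∏ p : Plaquette d L, w (plaquetteHolonomy V p.1 p.2.1.1 p.2.1.2) ∂(Measure.pi fun _ : Edge d L => haarProbability G)) /
          ((∫ V, ∏ p ∈ B, w (plaquetteHolonomy V p.1 p.2.1.1 p.2.1.2)
            ∂(Measure.pi fun _ : Edge d L => haarProbability G)) *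
            ∏ p ∈ Finset.univ \ B, w (plaquetteHolonomy U p.1 p.2.1.1 p.2.1.2))) with hρ
  have hw0' : ∀ U, 0 < (ρ U)⁻¹ := fun U => inv_pos.2 (hρpos U)
  have hπ' : (q.withDensity fun U => ENNReal.ofReal (ρ U)⁻¹) = π := withDensity_inv_density hρm hρpos hρq
  haveI : IsProbabilityMeasure (q.withDensity fun U => ENNReal.ofReal (ρ U)⁻¹) := by rw [hπ']; infer_instance
  have hone : ∫⁻ y, ENNReal.ofReal (ρ y)⁻¹ ∂q = ENNReal.ofReal 1 := by
    have h : π Set.univ = 1 := measure_univ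
    rw [← hπ', withDensity_apply _ MeasurableSet.univ, Measure.restrict_univ] at h
    rw [h, ENNReal.ofReal_one]
  have hA' := imhAcceptMass_toReal_eq_of_forall_le (q := q) hw0' cold hmax zero_le_one hone
  have hrate : ((ρ cold)⁻¹)⁻¹ = ((∫ V, ∏ p : Plaquette d L, w (plaquetteHolonomy V p.1 p.2.1.1 p.2.1.2) ∂(Measure.pi fun _ : Edge d L => haarProbability G)) /
        ((∫ g, w g ∂(haarProbability G)) ^ B.card * M ^ (Finset.univ \ B).card)) := by
    rw [← hA, hA', one_div]
  have hrate' : (ρ cold)⁻¹ = ((∫ V, ∏ p : Plaquette d L, w (plaquetteHolonomy V p.1 p.2.1.1 p.2.1.2) ∂(Measure.pi fun _ : Edge d L => haarProbability G)) /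
        ((∫ g, w g ∂(haarProbability G)) ^ B.card * M ^ (Finset.univ \ B).card))⁻¹ := by
    rw [← hrate, inv_inv]
  have h := imh_replicas_anyStart_mse_le_explicit (q := q) hw0' hmax hf ha hc b hN hR hXm hlaw hind (x₀ := cold)
  rw [hπ', hrate, hrate'] at h
  exact h

/-- **WITH THE BURN-IN RULE** `log(1/ε) ≤ b·A`: `E(Ȳ − π f)² ≤ [(2/A − 1)·Var_π f/N + ε·D²]/R + (1 − 1/R)·(ε·D·min(1, (1/A)/N))²` for pairwise independent runs from arbitrary starts (exact one-plaquette heat-bath sampler, `A = Z/(c^{#B} M^k)`). [ours] -/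
theorem heatBath_replicas_anyStart_mse_le_of_log_le [MeasurableSingletonClass G] (hL : 2 ≤ L) {w : G → ℝ} (hw : Continuous w) {m M : ℝ} (hm0 : 0 < m)
    (hm : ∀ g, m ≤ w g) (hM : ∀ g, w g ≤ M) (hw1 : w 1 = M)
    (B : Finset (Plaquette d L)) (t : Plaquette d L → Edge d L)
    (ht : ∀ p ∈ B, t p ∈ ({(p.1, p.2.1.1), (p.1.shift p.2.1.1, p.2.1.2),
        (p.1.shift p.2.1.2, p.2.1.1), (p.1, p.2.1.2)} : Finset (Edge d L)))
    (rank : Plaquette d L → ℕ)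
    (hrank : ∀ p ∈ B, ∀ p' ∈ B, p ≠ p' → t p ∈ ({(p'.1, p'.2.1.1), (p'.1.shift p'.2.1.1, p'.2.1.2),
        (p'.1.shift p'.2.1.2, p'.2.1.1), (p'.1, p'.2.1.2)} : Finset (Edge d L)) → rank p < rank p')
    (π q : Measure (GaugeConfig d L G)) [IsProbabilityMeasure π] [IsProbabilityMeasure q]
    (hπ : π = (Measure.pi fun _ : Edge d L => haarProbability G).withDensity fun U =>
      ENNReal.ofReal ((∏ p : Plaquette d L, w (plaquetteHolonomy U p.1 p.2.1.1 p.2.1.2)) /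
        ∫ V, ∏ p : Plaquette d L, w (plaquetteHolonomy V p.1 p.2.1.1 p.2.1.2)
          ∂(Measure.pi fun _ : Edge d L => haarProbability G)))
    (hq : q = (Measure.pi fun _ : Edge d L => haarProbability G).withDensity fun U =>
      ENNReal.ofReal ((∏ p ∈ B, w (plaquetteHolonomy U p.1 p.2.1.1 p.2.1.2)) /
        ∫ V, ∏ p ∈ B, w (plaquetteHolonomy V p.1 p.2.1.1 p.2.1.2)
          ∂(Measure.pi fun _ : Edge d L => haarProbability G)))
    [Fact (Measurable (fun U =>
        ((∫ V, ∏ p : Plaquette d L, w (plaquetteHolonomy V p.1 p.2.1.1 p.2.1.2) ∂(Measure.pi fun _ : Edge d L => haarProbability G)) /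
          ((∫ V, ∏ p ∈ B, w (plaquetteHolonomy V p.1 p.2.1.1 p.2.1.2)
            ∂(Measure.pi fun _ : Edge d L => haarProbability G)) *
            ∏ p ∈ Finset.univ \ B, w (plaquetteHolonomy U p.1 p.2.1.1 p.2.1.2)))⁻¹))]
    {Ω' : Type*} {mΩ' : MeasurableSpace Ω'} {μ : Measure Ω'} [IsProbabilityMeasure μ]
    {X : ℕ → Ω' → (ℕ → GaugeConfig d L G)} {μ₀ : ℕ → Measure (GaugeConfig d L G)} [∀ j, IsProbabilityMeasure (μ₀ j)] {R : ℕ}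
    {f : GaugeConfig d L G → ℝ} (hf : Measurable f) {a c : ℝ} (ha : ∀ U, a ≤ f U) (hc : ∀ U, f U ≤ c) {b N : ℕ}
    (hN : N ≠ 0) (hXm : ∀ j, Measurable (X j))
    (hlaw : ∀ j < R, μ.map (X j) = (Kernel.trajMeasure (X := fun _ : ℕ => GaugeConfig d L G) (μ₀ j)
        (fun n : ℕ => (indepMH q (fun U =>
        ((∫ V, ∏ p : Plaquette d L, w (plaquetteHolonomy V p.1 p.2.1.1 p.2.1.2) ∂(Measure.pi fun _ : Edge d L => haarProbability G)) /
          ((∫ V, ∏ p ∈ B, w (plaquetteHolonomy V p.1 p.2.1.1 p.2.1.2)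
            ∂(Measure.pi fun _ : Edge d L => haarProbability G)) *
            ∏ p ∈ Finset.univ \ B, w (plaquetteHolonomy U p.1 p.2.1.1 p.2.1.2)))⁻¹)).comap
          (fun h : (i : ↥(Finset.Iic n)) → GaugeConfig d L G => h ⟨n, Finset.mem_Iic.2 le_rfl⟩)
          (measurable_pi_apply _)))) (hR : R ≠ 0)
    (hind : ∀ i < R, ∀ j < R, i ≠ j → IndepFun (X i) (X j) μ) {ε : ℝ} (hε : 0 < ε)
    (hb : Real.log (1 / ε) ≤ b * ((∫ V, ∏ p : Plaquette d L, w (plaquetteHolonomy V p.1 p.2.1.1 p.2.1.2) ∂(Measure.pi fun _ : Edge d L => haarProbability G)) /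
        ((∫ g, w g ∂(haarProbability G)) ^ B.card * M ^ (Finset.univ \ B).card))) :
    ∫ ω, (replicaMean (fun j ω => (∑ i ∈ range N, f (X j ω (b + i))) / N) R ω - ∫ U, f U ∂π) ^ 2 ∂μ ≤
      ((2 * ((∫ V, ∏ p : Plaquette d L, w (plaquetteHolonomy V p.1 p.2.1.1 p.2.1.2) ∂(Measure.pi fun _ : Edge d L => haarProbability G)) /
        ((∫ g, w g ∂(haarProbability G)) ^ B.card * M ^ (Finset.univ \ B).card))⁻¹ - 1) *
            (∫ U, (f U - ∫ V, f V ∂π) ^ 2 ∂π) / N +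
          ε * (max (∫ U, f U ∂π - a) (c - ∫ U, f U ∂π)) ^ 2) / R +
        (1 - 1 / R) * (max (∫ U, f U ∂π - a) (c - ∫ U, f U ∂π) *
          (ε * min 1 (((∫ V, ∏ p : Plaquette d L, w (plaquetteHolonomy V p.1 p.2.1.1 p.2.1.2) ∂(Measure.pi fun _ : Edge d L => haarProbability G)) /
        ((∫ g, w g ∂(haarProbability G)) ^ B.card * M ^ (Finset.univ \ B).card))⁻¹ / N))) ^ 2 := by
  obtain ⟨hA, hρq, hmax, hρm, hρpos⟩ := heatBath_cold_acceptMass_eq hL hw hm0 hm hM hw1 B t ht rank hrank π q hπ hq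
  set cold : GaugeConfig d L G := fun _ => (1 : G) with hcold
  set ρ : GaugeConfig d L G → ℝ := fun U => ((∫ V, ∏ p : Plaquette d L, w (plaquetteHolonomy V p.1 p.2.1.1 p.2.1.2) ∂(Measure.pi fun _ : Edge d L => haarProbability G)) /
          ((∫ V, ∏ p ∈ B, w (plaquetteHolonomy V p.1 p.2.1.1 p.2.1.2)
            ∂(Measure.pi fun _ : Edge d L => haarProbability G)) *
            ∏ p ∈ Finset.univ \ B, w (plaquetteHolonomy U p.1 p.2.1.1 p.2.1.2))) with hρ
  have hw0' : ∀ U, 0 < (ρ U)⁻¹ := fun U => inv_pos.2 (hρpos U)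
  have hπ' : (q.withDensity fun U => ENNReal.ofReal (ρ U)⁻¹) = π := withDensity_inv_density hρm hρpos hρq
  haveI : IsProbabilityMeasure (q.withDensity fun U => ENNReal.ofReal (ρ U)⁻¹) := by rw [hπ']; infer_instance
  have hone : ∫⁻ y, ENNReal.ofReal (ρ y)⁻¹ ∂q = ENNReal.ofReal 1 := by
    have h : π Set.univ = 1 := measure_univ
    rw [← hπ', withDensity_apply _ MeasurableSet.univ, Measure.restrict_univ] at h
    rw [h, ENNReal.ofReal_one]
  have hA' := imhAcceptMass_toReal_eq_of_forall_le (q := q) hw0' cold hmax zero_le_one hone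
  have hrate : ((ρ cold)⁻¹)⁻¹ = ((∫ V, ∏ p : Plaquette d L, w (plaquetteHolonomy V p.1 p.2.1.1 p.2.1.2) ∂(Measure.pi fun _ : Edge d L => haarProbability G)) /
        ((∫ g, w g ∂(haarProbability G)) ^ B.card * M ^ (Finset.univ \ B).card)) := by
    rw [← hA, hA', one_div]
  have hrate' : (ρ cold)⁻¹ = ((∫ V, ∏ p : Plaquette d L, w (plaquetteHolonomy V p.1 p.2.1.1 p.2.1.2) ∂(Measure.pi fun _ : Edge d L => haarProbability G)) /
        ((∫ g, w g ∂(haarProbability G)) ^ B.card * M ^ (Finset.univ \ B).card))⁻¹ := by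
    rw [← hrate, inv_inv]
  rw [← hrate] at hb
  have h := imh_replicas_anyStart_mse_le_explicit_of_log_le (q := q) hw0' hmax hf ha hc hN hR hXm hlaw hind hε hb (x₀ := cold)
  rw [hπ', hrate'] at h
  exact h

/-- **THE MEDIAN OF RUNS FROM ARBITRARY STARTS**: mutually independent runs and `4·[(2/A − 1)·Var_π f/N + (1 − A)^b·D²] ≤ s²` ⇒ `P(#{j < R : |Y_j − π f| ≥ s} ≥ R/2) ≤ exp(−R/8)`: on the complement every sample median of the `R` window averages is within `s` of `π f`, whatever the starts (exact one-plaquette heat-bath sampler, `A = Z/(c^{#B} M^k)`). [ours] -/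
theorem heatBath_replicas_anyStart_median [MeasurableSingletonClass G] (hL : 2 ≤ L) {w : G → ℝ} (hw : Continuous w) {m M : ℝ} (hm0 : 0 < m)
    (hm : ∀ g, m ≤ w g) (hM : ∀ g, w g ≤ M) (hw1 : w 1 = M)
    (B : Finset (Plaquette d L)) (t : Plaquette d L → Edge d L)
    (ht : ∀ p ∈ B, t p ∈ ({(p.1, p.2.1.1), (p.1.shift p.2.1.1, p.2.1.2),
        (p.1.shift p.2.1.2, p.2.1.1), (p.1, p.2.1.2)} : Finset (Edge d L)))
    (rank : Plaquette d L → ℕ)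
    (hrank : ∀ p ∈ B, ∀ p' ∈ B, p ≠ p' → t p ∈ ({(p'.1, p'.2.1.1), (p'.1.shift p'.2.1.1, p'.2.1.2),
        (p'.1.shift p'.2.1.2, p'.2.1.1), (p'.1, p'.2.1.2)} : Finset (Edge d L)) → rank p < rank p')
    (π q : Measure (GaugeConfig d L G)) [IsProbabilityMeasure π] [IsProbabilityMeasure q]
    (hπ : π = (Measure.pi fun _ : Edge d L => haarProbability G).withDensity fun U =>
      ENNReal.ofReal ((∏ p : Plaquette d L, w (plaquetteHolonomy U p.1 p.2.1.1 p.2.1.2)) /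
        ∫ V, ∏ p : Plaquette d L, w (plaquetteHolonomy V p.1 p.2.1.1 p.2.1.2)
          ∂(Measure.pi fun _ : Edge d L => haarProbability G)))
    (hq : q = (Measure.pi fun _ : Edge d L => haarProbability G).withDensity fun U =>
      ENNReal.ofReal ((∏ p ∈ B, w (plaquetteHolonomy U p.1 p.2.1.1 p.2.1.2)) /
        ∫ V, ∏ p ∈ B, w (plaquetteHolonomy V p.1 p.2.1.1 p.2.1.2)
          ∂(Measure.pi fun _ : Edge d L => haarProbability G)))
    [Fact (Measurable (fun U =>
        ((∫ V, ∏ p : Plaquette d L, w (plaquetteHolonomy V p.1 p.2.1.1 p.2.1.2) ∂(Measure.pi fun _ : Edge d L => haarProbability G)) /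
          ((∫ V, ∏ p ∈ B, w (plaquetteHolonomy V p.1 p.2.1.1 p.2.1.2)
            ∂(Measure.pi fun _ : Edge d L => haarProbability G)) *
            ∏ p ∈ Finset.univ \ B, w (plaquetteHolonomy U p.1 p.2.1.1 p.2.1.2)))⁻¹))]
    {Ω' : Type*} {mΩ' : MeasurableSpace Ω'} {μ : Measure Ω'} [IsProbabilityMeasure μ]
    {X : ℕ → Ω' → (ℕ → GaugeConfig d L G)} {μ₀ : ℕ → Measure (GaugeConfig d L G)} [∀ j, IsProbabilityMeasure (μ₀ j)] {R : ℕ}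
    {f : GaugeConfig d L G → ℝ} (hf : Measurable f) {a c : ℝ} (ha : ∀ U, a ≤ f U) (hc : ∀ U, f U ≤ c) (b : ℕ) {N : ℕ}
    (hN : N ≠ 0) (hXm : ∀ j, Measurable (X j))
    (hlaw : ∀ j < R, μ.map (X j) = (Kernel.trajMeasure (X := fun _ : ℕ => GaugeConfig d L G) (μ₀ j)
        (fun n : ℕ => (indepMH q (fun U =>
        ((∫ V, ∏ p : Plaquette d L, w (plaquetteHolonomy V p.1 p.2.1.1 p.2.1.2) ∂(Measure.pi fun _ : Edge d L => haarProbability G)) /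
          ((∫ V, ∏ p ∈ B, w (plaquetteHolonomy V p.1 p.2.1.1 p.2.1.2)
            ∂(Measure.pi fun _ : Edge d L => haarProbability G)) *
            ∏ p ∈ Finset.univ \ B, w (plaquetteHolonomy U p.1 p.2.1.1 p.2.1.2)))⁻¹)).comap
          (fun h : (i : ↥(Finset.Iic n)) → GaugeConfig d L G => h ⟨n, Finset.mem_Iic.2 le_rfl⟩)
          (measurable_pi_apply _))))
    (hind : iIndepFun X μ) {s : ℝ} (hs : 0 < s)
    (hs2 : 4 * ((2 * ((∫ V, ∏ p : Plaquette d L, w (plaquetteHolonomy V p.1 p.2.1.1 p.2.1.2) ∂(Measure.pi fun _ : Edge d L => haarProbability G)) /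
        ((∫ g, w g ∂(haarProbability G)) ^ B.card * M ^ (Finset.univ \ B).card))⁻¹ - 1) *
            (∫ U, (f U - ∫ V, f V ∂π) ^ 2 ∂π) / N +
          (1 - ((∫ V, ∏ p : Plaquette d L, w (plaquetteHolonomy V p.1 p.2.1.1 p.2.1.2) ∂(Measure.pi fun _ : Edge d L => haarProbability G)) /
        ((∫ g, w g ∂(haarProbability G)) ^ B.card * M ^ (Finset.univ \ B).card))) ^ b * (max (∫ U, f U ∂π - a) (c - ∫ U, f U ∂π)) ^ 2) ≤ s ^ 2) :
    μ.real {ω | (R : ℝ) / 2 ≤ #{j ∈ range R |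
        s ≤ |(∑ i ∈ range N, f (X j ω (b + i))) / N - ∫ U, f U ∂π|}} ≤
      Real.exp (-(R / 8)) := by
  obtain ⟨hA, hρq, hmax, hρm, hρpos⟩ := heatBath_cold_acceptMass_eq hL hw hm0 hm hM hw1 B t ht rank hrank π q hπ hq
  set cold : GaugeConfig d L G := fun _ => (1 : G) with hcold
  set ρ : GaugeConfig d L G → ℝ := fun U => ((∫ V, ∏ p : Plaquette d L, w (plaquetteHolonomy V p.1 p.2.1.1 p.2.1.2) ∂(Measure.pi fun _ : Edge d L => haarProbability G)) /
          ((∫ V, ∏ p ∈ B, w (plaquetteHolonomy V p.1 p.2.1.1 p.2.1.2)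
            ∂(Measure.pi fun _ : Edge d L => haarProbability G)) *
            ∏ p ∈ Finset.univ \ B, w (plaquetteHolonomy U p.1 p.2.1.1 p.2.1.2))) with hρ
  have hw0' : ∀ U, 0 < (ρ U)⁻¹ := fun U => inv_pos.2 (hρpos U)
  have hπ' : (q.withDensity fun U => ENNReal.ofReal (ρ U)⁻¹) = π := withDensity_inv_density hρm hρpos hρq
  haveI : IsProbabilityMeasure (q.withDensity fun U => ENNReal.ofReal (ρ U)⁻¹) := by rw [hπ']; infer_instance
  have hone : ∫⁻ y, ENNReal.ofReal (ρ y)⁻¹ ∂q = ENNReal.ofReal 1 := by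
    have h : π Set.univ = 1 := measure_univ
    rw [← hπ', withDensity_apply _ MeasurableSet.univ, Measure.restrict_univ] at h
    rw [h, ENNReal.ofReal_one]
  have hA' := imhAcceptMass_toReal_eq_of_forall_le (q := q) hw0' cold hmax zero_le_one hone
  have hrate : ((ρ cold)⁻¹)⁻¹ = ((∫ V, ∏ p : Plaquette d L, w (plaquetteHolonomy V p.1 p.2.1.1 p.2.1.2) ∂(Measure.pi fun _ : Edge d L => haarProbability G)) /
        ((∫ g, w g ∂(haarProbability G)) ^ B.card * M ^ (Finset.univ \ B).card)) := by
    rw [← hA, hA', one_div]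
  have hrate' : (ρ cold)⁻¹ = ((∫ V, ∏ p : Plaquette d L, w (plaquetteHolonomy V p.1 p.2.1.1 p.2.1.2) ∂(Measure.pi fun _ : Edge d L => haarProbability G)) /
        ((∫ g, w g ∂(haarProbability G)) ^ B.card * M ^ (Finset.univ \ B).card))⁻¹ := by
    rw [← hrate, inv_inv]
  rw [← hrate'] at hs2
  rw [← hrate] at hs2
  rw [← hπ'] at hs2
  have h := imh_replicas_anyStart_median (q := q) hw0' hmax hf ha hc b hN hXm hlaw hind hs hs2 (x₀ := cold)
  rw [hπ'] at h
  exact h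

end Summit.Ventures.LatticeQCDFlow.Theory2.Autoregressive

end
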